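import Summits.HodgeConjecture.HodgeConjecture.Theorems.Ring2AbelianAllAndreFibreClassDivisorialOfHodgeType
import HarnessLib

/-!
# Ring 2 · sub-cell AbelianAll (ALL ABELIAN VARIETIES), André axis, part XV-b — EXACTNESS OF THE REDUCTION AT AN
# ALGEBRAIC FIBRE: on a compact pencil one of whose fibres has ALGEBRAIC invariant classes (e.g. a CM fibre with
# Hodge invariants, under `HC_CM`), the fibre-class Lefschetz node (β′_f) is EQUIVALENT to the liftability nodes
# (N_p)(t₀) of part XIV — so on the Weil habitat (W_E)₃ the Lefschetz route to W₆ IS the lifting problem for the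
# CM fibre's invariant classes, no more and no less

HONEST FRAMING (page 1, verbatim): **research route, not a corollary; conditional on HC_CM plus one named
minimal statement.** Cell line: research route conditional on HC_CM; not a corollary; Q11.4-sentence-2
already refuted in dim ≥ 3. Nothing in this file proves a case of the Hodge conjecture for an abelian variety.
`HC_CM` = `Theses.RankFourFaces.CMAbelianHodge` (a BINDER wherever it occurs, never cited, never an axiom), item
`Theses.RankFourFaces.CMToAbelian` (stmt-16267) OPEN and not closed here. Seat `pub-hodge-ring2-ab-andre-2`,
gen 7; sharpens finding AA2.45 of RING2-MAP §AbelianAll (the "W₆ circularity") into a kernel EQUIVALENCE.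

## What is proved (theorems only; no definition, no named fact, no sorry)

For a compact pencil `f : 𝒳 ⟶ S` of abelian `d`-folds (`hf : IsCompactAbelianPencil f d`) and a point `t₀`, say
that **the invariant classes of degree `2p` are algebraic on the fibre at `t₀`** if
`j_{t₀}^* H²ᵖ(𝒳(ℂ); ℂ) ⊆ Nᵖ H²ᵖ(𝒳_{t₀}(ℂ); ℂ)` (a hypothesis written out, not a definition).

* §1 **(β′_f) ⟹ (N_p)(t₀) at an algebraic fibre** (`algebraicInvariantClassesAt_of_fibreClassLefschetzOn_of_fibre`;
  Abdulali's Theorem 5.5 = part VIII's engine `exists_algebraic_lift_of_fibreClassLefschetzOn`), and per clause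
  (`algebraicInvariantClassesAt_of_clause_of_fibre`: the degree-`p` clause alone lifts, `η = T(j_{t₀*} j_{t₀}^* W)`).
* §2 **Exactness**: if the invariant classes are algebraic on the fibre at `t₀` in all degrees `2p`, `2p ≤ d`, then
  **`FibreClassLefschetzOn hf ↔ ∀ p, 2p ≤ d → AlgebraicInvariantClassesAt hf t₀ p`**
  (`fibreClassLefschetzOn_iff_algebraicInvariantClassesAt_half_of_fibre`; ⟸ is part XIV-g's
  `fibreClassLefschetzOn_of_algebraicInvariants_half`), and the all-degrees form.
* §3 **Hodge invariants + the Hodge conjecture FOR THE FIBRE ⟹ algebraic fibre**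
  (`map_fiberι_mem_algebraicClasses_of_hodgeType_of_fibre`: rational classes span `H²ᵖ(𝒳)`; if every rational `W`
  restricts to a `(p,p)`-class and rational `(p,p)`-classes of `𝒳_{t₀}` are algebraic, every `j_{t₀}^* W` is
  algebraic); at a CM point `t₀ ∈ cmLocus f d` the second input is `HC_CM`
  (`map_fiberι_mem_algebraicClasses_of_hodgeType_of_HC_CM`, via `Ring2Transport.mem_algebraicClasses_of_cmChart` —
  the ONLY place `HC_CM` enters).
* §4 **The `HC_CM` rows.** `fibreClassLefschetzOn_iff_algebraicInvariantClassesAt_of_HC_CM`: for a compact pencil with a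
  CM fibre `t₀` at which the rational invariant classes of degrees `2p ≤ d` are of type `(p,p)` ("HODGE INVARIANTS",
  print-true whenever the monodromy is big, e.g. `I_{2p} = ℚθᵖ`, and on the Weil habitat), `HC_CM ⊢ (β′_f) ⟺
  ⋀_{2p ≤ d} (N_p)(t₀)`. **`fibreClassLefschetzOn_iff_relDim_six_of_HC_CM`**: for abelian-SIXFOLD pencils,
  `HC_CM ⊢ (β′_f) ⟺ (N₁)(t₀) ∧ (N₂)(t₀) ∧ (N₃)(t₀)`.

## Reading (RING2-MAP §AbelianAll (ab-andre-2, gen 7))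

AA2.45 observed that PRODUCT cycles give a quasi-inverse of `∪[𝒳_t]` in degree `p` iff (N_p) ∧ (N_{d-p}), and that
on a (W_E)₃-pencil (N₃) contains W₆. This part shows the converse is forced: under `HC_CM` (the cell's standing
hypothesis) and Hodge invariants at the CM fibre, ANY witness of (β′_f) — product or not, balanced or not (part
XV-a) — yields (N_p)(t₀) for all `p` (Abdulali 5.5), and conversely (N_•)(t₀) rebuilds (β′_f) from product cycles
(part XIV). So on such pencils **(β′_f) ⟺ "every Hodge invariant class of the CM fibre is the restriction of an
algebraic class of `𝒳`"**, and for the W₆ habitat the Lefschetz node (β′)_6 restricted to (W_E)₃-pencils is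
EQUIVALENT (mod `HC_CM`) to lifting the CM fibre's classes `θ, θ², θ³, ω, ω̄` to algebraic classes on the 7-fold
`𝒳`: the non-product cycle of AA2.45 / part XV-a exists iff the product cycles already do. The Lefschetz column
therefore adds NO route to W₆ beyond the lift (L) of part I at CM fibres — a precise negative structural result;
its positive content remains the unconditional rungs `d ≤ 3` (parts XIV-c/d/f/h).

NOT CLAIMED: Hodge invariance for any concrete pencil (a typed hypothesis); (N_p) for any `p ≥ 1` on a Weil
pencil; any case of the Hodge conjecture. `HC_CM` is an explicit hypothesis of the §4 rows only.

References: Abdulali1994FamiliesAV (Conj. 5.3, Thm. 5.5 p. 1130, Lemma 6.2); Andre1996Motifs (§5.1, §6.3 Lemme 6.3.1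
and Remarque 2, pp. 31–33); VoisinHodgeII2003 ((10.7), Prop. 9.21); Voisin2025 (Prop. 2.11); Milne1999 (§7 p. 72);
Deligne1982HodgeCycles (§5, Prop. 6.1).
-/

noncomputable section

set_option linter.dupNamespace false

namespace Summit.HodgeConjecture.HodgeConjecture.Ring2.AbelianAll

open CategoryTheory AlgebraicGeometry MonoidalCategory CartesianMonoidalCategory
open Literature.AlgebraicGeometry Literature.AlgebraicGeometry.Motives
open Literature.AlgebraicGeometry.HodgeTheory
open Literature.AlgebraicTopology.SingularHomology (singularCohomology)
open Literature.AlgebraicGeometry.Milne1999 (IsOfCMType)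
open Literature.AlgebraicGeometry.Deligne1982 (cmLocus)
open Summit.HodgeConjecture.HodgeConjecture.Theses

variable {𝒳 S : SchemeOver ℂ}

/-! ## §1 (β′_f) ⟹ (N_p)(t₀) at a fibre whose invariant classes are algebraic (Abdulali's Theorem 5.5) -/

/-- **(β′_f) ⟹ (N_p)(t₀) at an algebraic fibre.** If `FibreClassLefschetzOn hf` holds and every class of
`j_{t₀}^* H²ᵖ(𝒳)` is algebraic ON THE FIBRE `𝒳_{t₀}`, then every class of `H²ᵖ(𝒳)` agrees on `𝒳_{t₀}` with a
global ALGEBRAIC class: part VIII's engine (Abdulali's Theorem 5.5 on the carriers) lifts `j_{t₀}^* W` to an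
algebraic `η` with `j_s^* η = j_s^* W` for every `s`. [cite: Abdulali1994FamiliesAV, Theorem 5.5 (p. 1130)] -/
theorem algebraicInvariantClassesAt_of_fibreClassLefschetzOn_of_fibre {d : ℕ} {f : 𝒳 ⟶ S}
    (hf : IsCompactAbelianPencil f d) (hF : FibreClassLefschetzOn hf) (t₀ : ComplexPoints S) (p : ℕ)
    (halg : ∀ W : complexBetti 𝒳 (2 * p),
      complexBetti.map (fiberι f t₀) (2 * p) W ∈ algebraicClasses (fiberOver f t₀) p) :
    AlgebraicInvariantClassesAt hf t₀ p := fun W ↦ by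
  obtain ⟨η, hη, hs⟩ := exists_algebraic_lift_of_fibreClassLefschetzOn hf hF W (halg W)
  exact ⟨η, hη, hs t₀⟩

/-- **Per clause**: the degree-`p` clause of (β′_f) alone (an algebraic correspondence `T` with
`j_s^* T j_{t*} j_t^* = j_s^*`) gives (N_p)(t₀) at an algebraic fibre — `η := T(j_{t₀*} j_{t₀}^* W)` is algebraic
(`j_{t₀*}` and `T` preserve algebraic classes, part V) and `j_{t₀}^* η = j_{t₀}^* W`.
[cite: Abdulali1994FamiliesAV, Theorem 5.5 (p. 1130)] [cite: VoisinHodgeII2003, §9.2.4 Prop. 9.21 and (10.7)] -/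
theorem algebraicInvariantClassesAt_of_clause_of_fibre {d : ℕ} {f : 𝒳 ⟶ S} (hf : IsCompactAbelianPencil f d)
    (t₀ : ComplexPoints S) (p : ℕ) {T : complexBetti 𝒳 (2 * (p + 1)) →ₗ[ℂ] complexBetti 𝒳 (2 * p)}
    (hT : IsAlgebraicCorrespondence (d + 1) (d + 1) 𝒳 𝒳 T)
    (hTid : ∀ (W : complexBetti 𝒳 (2 * p)) (t s : ComplexPoints S),
      complexBetti.map (fiberι f s) (2 * p) (T (fiberGysin hf t p (complexBetti.map (fiberι f t) (2 * p) W))) =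
        complexBetti.map (fiberι f s) (2 * p) W)
    (halg : ∀ W : complexBetti 𝒳 (2 * p),
      complexBetti.map (fiberι f t₀) (2 * p) W ∈ algebraicClasses (fiberOver f t₀) p) :
    AlgebraicInvariantClassesAt hf t₀ p := fun W ↦
  ⟨T (fiberGysin hf t₀ p (complexBetti.map (fiberι f t₀) (2 * p) W)),
    map_mem_algebraicClasses_of_isAlgebraicCorrespondence hf.isSmoothProjective_total hf.isSmoothProjective_total hT
      (fiberGysin_mem_algebraicClasses hf t₀ (halg W)),
    hTid W t₀ t₀⟩

/-! ## §2 Exactness: at an algebraic fibre, (β′_f) ⟺ ⋀ (N_p)(t₀) -/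

/-- **EXACTNESS (all degrees).** If the invariant classes of every degree `2p`, `p ≤ d`, are algebraic on the fibre
at `t₀`, then `FibreClassLefschetzOn hf ↔ ∀ p ≤ d, AlgebraicInvariantClassesAt hf t₀ p` (§1 and part XIV-e/f's
product cycles `∑ Dᵢ × Aᵢ`). [cite: Abdulali1994FamiliesAV, Conjecture 5.3 and Theorem 5.5 (p. 1130)] -/
theorem fibreClassLefschetzOn_iff_algebraicInvariantClassesAt_of_fibre {d : ℕ} {f : 𝒳 ⟶ S}
    (hf : IsCompactAbelianPencil f d) (t₀ : ComplexPoints S)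
    (halg : ∀ p ≤ d, ∀ W : complexBetti 𝒳 (2 * p),
      complexBetti.map (fiberι f t₀) (2 * p) W ∈ algebraicClasses (fiberOver f t₀) p) :
    FibreClassLefschetzOn hf ↔ ∀ p ≤ d, AlgebraicInvariantClassesAt hf t₀ p :=
  ⟨fun hF p hp ↦ algebraicInvariantClassesAt_of_fibreClassLefschetzOn_of_fibre hf hF t₀ p (halg p hp),
    fibreClassLefschetzOn_of_algebraicInvariantClassesAt hf t₀⟩

/-- **EXACTNESS (lower half).** If the invariant classes of the degrees `2p` with `2p ≤ d` are algebraic on the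
fibre at `t₀`, then `FibreClassLefschetzOn hf ↔ ∀ p, 2p ≤ d → AlgebraicInvariantClassesAt hf t₀ p` (§1 and part
XIV-g's `fibreClassLefschetzOn_of_algebraicInvariants_half`: the upper half follows by hard Lefschetz).
[cite: Abdulali1994FamiliesAV, Conjecture 5.3 and Theorem 5.5 (p. 1130)] [cite: VoisinHodgeI2002, §6.2.3 Thm. 6.25] -/
theorem fibreClassLefschetzOn_iff_algebraicInvariantClassesAt_half_of_fibre {d : ℕ} {f : 𝒳 ⟶ S}
    (hf : IsCompactAbelianPencil f d) (t₀ : ComplexPoints S)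
    (halg : ∀ p, 2 * p ≤ d → ∀ W : complexBetti 𝒳 (2 * p),
      complexBetti.map (fiberι f t₀) (2 * p) W ∈ algebraicClasses (fiberOver f t₀) p) :
    FibreClassLefschetzOn hf ↔ ∀ p, 2 * p ≤ d → AlgebraicInvariantClassesAt hf t₀ p :=
  ⟨fun hF p hp ↦ algebraicInvariantClassesAt_of_fibreClassLefschetzOn_of_fibre hf hF t₀ p (halg p hp),
    fibreClassLefschetzOn_of_algebraicInvariants_half hf t₀⟩

/-! ## §3 Hodge invariants and the Hodge conjecture for the fibre make the fibre algebraic -/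

/-- **Hodge invariants + HC for the fibre ⟹ the invariant classes are algebraic on the fibre.** If every RATIONAL
class `W ∈ H²ᵖ(𝒳)` restricts to a class of Hodge type `(p,p)` on `𝒳_{t₀}` and the rational `(p,p)`-classes of
`𝒳_{t₀}` are algebraic, then `j_{t₀}^* W` is algebraic for EVERY (complex) `W`: rational classes span
`H²ᵖ(𝒳(ℂ); ℂ)` (`span_isRationalClass_eq_top_of_isSmoothProjective_holds`) and the algebraic classes form a
`ℂ`-subspace. [cite: Voisin2025, Prop. 2.11 and Lemma 2.9] [cite: VoisinHodgeI2002, §11.3.3 Lemma 11.41] -/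
theorem map_fiberι_mem_algebraicClasses_of_hodgeType_of_fibre {d : ℕ} {f : 𝒳 ⟶ S} (hf : IsCompactAbelianPencil f d)
    (t₀ : ComplexPoints S) (p : ℕ)
    (hpp : ∀ W : complexBetti 𝒳 (2 * p), IsRationalClass W →
      IsOfHodgeType d (fiberOver f t₀) (2 * p) p p (complexBetti.map (fiberι f t₀) (2 * p) W))
    (hHC : ∀ c : complexBetti (fiberOver f t₀) (2 * p), IsRationalClass c →
      IsOfHodgeType d (fiberOver f t₀) (2 * p) p p c → c ∈ algebraicClasses (fiberOver f t₀) p)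
    (W : complexBetti 𝒳 (2 * p)) :
    complexBetti.map (fiberι f t₀) (2 * p) W ∈ algebraicClasses (fiberOver f t₀) p := by
  have h𝒳 := hf.isSmoothProjective_total
  have hle : ⊤ ≤ (algebraicClasses (fiberOver f t₀) p).comap (complexBetti.map (fiberι f t₀) (2 * p)).hom := by
    rw [← span_isRationalClass_eq_top_of_isSmoothProjective_holds (d + 1) 𝒳 h𝒳 (2 * p)]
    exact Submodule.span_le.2 fun W hW ↦ hHC _ (hW.pullback _) (hpp W hW)
  exact hle Submodule.mem_top

/-- **At a CM fibre, `HC_CM` supplies the Hodge conjecture for the fibre**: if `t₀ ∈ cmLocus f d` and every rational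
`W ∈ H²ᵖ(𝒳)` restricts to a `(p,p)`-class on `𝒳_{t₀}`, then under `HC_CM` every `j_{t₀}^* W` is algebraic on
`𝒳_{t₀}` (`Ring2Transport.mem_algebraicClasses_of_cmChart` — the ONLY use of `HC_CM` in this file).
research route, not a corollary; conditional on HC_CM plus one named minimal statement.
[cite: Milne1999, §7 p. 72] [cite: Deligne1982HodgeCycles, §5 and proof of Prop. 6.1 (p. 73)] -/
theorem map_fiberι_mem_algebraicClasses_of_hodgeType_of_HC_CM (hCM : RankFourFaces.CMAbelianHodge) {d : ℕ}
    {f : 𝒳 ⟶ S} (hf : IsCompactAbelianPencil f d) {t₀ : ComplexPoints S} (ht₀ : t₀ ∈ cmLocus f d) (p : ℕ)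
    (hpp : ∀ W : complexBetti 𝒳 (2 * p), IsRationalClass W →
      IsOfHodgeType d (fiberOver f t₀) (2 * p) p p (complexBetti.map (fiberι f t₀) (2 * p) W))
    (W : complexBetti 𝒳 (2 * p)) :
    complexBetti.map (fiberι f t₀) (2 * p) W ∈ algebraicClasses (fiberOver f t₀) p := by
  obtain ⟨A₀, ⟨e₀⟩, hdim, hcm⟩ := ht₀
  exact map_fiberι_mem_algebraicClasses_of_hodgeType_of_fibre hf t₀ p hpp
    (fun c hc hcpp ↦ Ring2Transport.mem_algebraicClasses_of_cmChart hCM A₀ e₀ hdim hcm hc hcpp) W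

/-! ## §4 The `HC_CM` rows: (β′_f) ⟺ ⋀ (N_p)(t₀) at a CM fibre with Hodge invariants -/

/-- **`HC_CM ⊢ (β′_f) ⟺ ⋀_{2p ≤ d} (N_p)(t₀)` on a compact pencil with a CM fibre `t₀` whose rational invariant
classes of degrees `2p ≤ d` are of Hodge type `(p,p)`.** The Lefschetz-type node of the André axis, restricted to
such pencils, is EQUIVALENT under `HC_CM` to the liftability of the CM fibre's invariant Hodge classes to algebraic
classes of the total space. research route, not a corollary; conditional on HC_CM plus one named minimal statement.
[cite: Abdulali1994FamiliesAV, Conjecture 5.3, Theorem 5.5 (p. 1130) and Lemma 6.2 (p. 1131)]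
[cite: Andre1996Motifs, §6.3 Lemme 6.3.1 and Remarque 2 (pp. 31–33)] -/
theorem fibreClassLefschetzOn_iff_algebraicInvariantClassesAt_of_HC_CM (hCM : RankFourFaces.CMAbelianHodge)
    {d : ℕ} {f : 𝒳 ⟶ S} (hf : IsCompactAbelianPencil f d) {t₀ : ComplexPoints S} (ht₀ : t₀ ∈ cmLocus f d)
    (hHodge : ∀ p, 2 * p ≤ d → ∀ W : complexBetti 𝒳 (2 * p), IsRationalClass W →
      IsOfHodgeType d (fiberOver f t₀) (2 * p) p p (complexBetti.map (fiberι f t₀) (2 * p) W)) :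
    FibreClassLefschetzOn hf ↔ ∀ p, 2 * p ≤ d → AlgebraicInvariantClassesAt hf t₀ p :=
  fibreClassLefschetzOn_iff_algebraicInvariantClassesAt_half_of_fibre hf t₀ fun p hp ↦
    map_fiberι_mem_algebraicClasses_of_hodgeType_of_HC_CM hCM hf ht₀ p (hHodge p hp)

/-- **The W₆ habitat: `HC_CM ⊢ (β′_f) ⟺ (N₁)(t₀) ∧ (N₂)(t₀) ∧ (N₃)(t₀)` for a compact pencil of abelian
SIXFOLDS with a CM fibre `t₀` at which the rational invariant classes of degrees `2, 4, 6` are Hodge classes**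
((N₀) is automatic, part XIV-f). For the big-monodromy Weil pencils of (W_E)₃ the degree-2 and -4 invariants are
`ℚθ`, `ℚθ²` and the degree-6 invariants `ℚθ³ ⊕ (Weil classes)` — all Hodge — so there the fibre-class Lefschetz
node is EXACTLY "`θ, θ², θ³` and the Weil classes of the CM fibre are restrictions of algebraic classes of the 7-fold
`𝒳`" (RING2-MAP AA2.45 made an equivalence). research route, not a corollary; conditional on HC_CM plus one named
minimal statement. [cite: Andre1996Motifs, §6.3 Remarque 2 (p. 33)] [cite: Abdulali1994FamiliesAV, Theorem 5.5 (p. 1130)] -/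
theorem fibreClassLefschetzOn_iff_relDim_six_of_HC_CM (hCM : RankFourFaces.CMAbelianHodge) {f : 𝒳 ⟶ S}
    (hf : IsCompactAbelianPencil f 6) {t₀ : ComplexPoints S} (ht₀ : t₀ ∈ cmLocus f 6)
    (hHodge : ∀ p, 1 ≤ p → p ≤ 3 → ∀ W : complexBetti 𝒳 (2 * p), IsRationalClass W →
      IsOfHodgeType 6 (fiberOver f t₀) (2 * p) p p (complexBetti.map (fiberι f t₀) (2 * p) W)) :
    FibreClassLefschetzOn hf ↔ AlgebraicInvariantClassesAt hf t₀ 1 ∧ AlgebraicInvariantClassesAt hf t₀ 2 ∧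
      AlgebraicInvariantClassesAt hf t₀ 3 := by
  have hN : ∀ p, 1 ≤ p → p ≤ 3 → FibreClassLefschetzOn hf → AlgebraicInvariantClassesAt hf t₀ p :=
    fun p hp1 hp3 hF ↦ algebraicInvariantClassesAt_of_fibreClassLefschetzOn_of_fibre hf hF t₀ p
      (map_fiberι_mem_algebraicClasses_of_hodgeType_of_HC_CM hCM hf ht₀ p (hHodge p hp1 hp3))
  refine ⟨fun hF ↦ ⟨hN 1 le_rfl (by omega) hF, hN 2 (by omega) (by omega) hF, hN 3 (by omega) le_rfl hF⟩,
    fun ⟨h₁, h₂, h₃⟩ ↦ fibreClassLefschetzOn_relDim_six_of_algebraicInvariants hf t₀ h₁ h₂ h₃⟩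

/-- **The same at ANY fibre**: (N_p) is independent of the fibre (part XIV-f `algebraicInvariantClassesAt_of_at`), so
under `HC_CM` and Hodge invariants at a CM fibre `t₀`, (β′_f) ⟺ ⋀_{2p ≤ d} (N_p)(t) for every `t`.
research route, not a corollary; conditional on HC_CM plus one named minimal statement.
[cite: Abdulali1994FamiliesAV, Theorem 5.5 (p. 1130)] [cite: DeligneHodgeII1971, Thm. 4.1.1] -/
theorem fibreClassLefschetzOn_iff_algebraicInvariantClassesAt_at_of_HC_CM (hCM : RankFourFaces.CMAbelianHodge)
    {d : ℕ} {f : 𝒳 ⟶ S} (hf : IsCompactAbelianPencil f d) {t₀ : ComplexPoints S} (ht₀ : t₀ ∈ cmLocus f d)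
    (hHodge : ∀ p, 2 * p ≤ d → ∀ W : complexBetti 𝒳 (2 * p), IsRationalClass W →
      IsOfHodgeType d (fiberOver f t₀) (2 * p) p p (complexBetti.map (fiberι f t₀) (2 * p) W))
    (t : ComplexPoints S) :
    FibreClassLefschetzOn hf ↔ ∀ p, 2 * p ≤ d → AlgebraicInvariantClassesAt hf t p := by
  rw [fibreClassLefschetzOn_iff_algebraicInvariantClassesAt_of_HC_CM hCM hf ht₀ hHodge]
  exact ⟨fun h p hp ↦ algebraicInvariantClassesAt_of_at hf (h p hp) t,
    fun h p hp ↦ algebraicInvariantClassesAt_of_at hf (h p hp) t₀⟩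

end Summit.HodgeConjecture.HodgeConjecture.Ring2.AbelianAll

end
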